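import Summits.BirchSwinnertonDyer.BirchSwinnertonDyer.Theses.ErratumRoadFive
import Summits.BirchSwinnertonDyer.Rank1Residual.GaloisImage.PropagatedConditionCardEP
import Literature.NumberTheory.GaloisRepresentations.NumberFieldCdTwoProofs
import Literature.NumberTheory.EllipticCurves.AnalyticRankModularityProofs
import HarnessLib
-- (buildfix 2026-08-28) explicit import: the route file's 03:58Z re-render no longer brings this module transitively
import Summits.BirchSwinnertonDyer.BirchSwinnertonDyer.Theorems.ErratumRoadFiveIMCDivRoadFFFittingFrameBOfMembers
import Summits.BirchSwinnertonDyer.BirchSwinnertonDyer.Theorems.ErratumRoadFiveKernelFromPrintBOfFacts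

/-!
# Route `ErratumRoadFive` (rung K2, `p ≥ 5`): THE PUBLISHED-INPUT SURFACE of the deciding theorem `closes` (rev 42) as ONE
# kernel-checked hypothesis list — support 19066 `PublishedInputsFive` from THIRTEEN of its fifteen conjuncts; the two bundles
# 19283 `PublishedInputsIMCReduction` ∧ 19066 (31 conjunct slots) from SEVENTEEN distinct named facts; the K2 leaf
# `X11b.MultiplicativeRankOne` from the route's 7 contentful items + 5 held inputs + the 17 named facts, atomised
# (cell `bsd-stepL`, seat `bsd-stepL-imc-p1` g17; `--supports stmt-BirchSwinnertonDyer-19066 --as helper`)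

This module imports the route file (its hypotheses and conclusions ARE route decls, by name), so no `_holds` link can be stated here.

## What this file proves (bookkeeping for the planner ∕ the D-0146 sufficiency map; nothing booked)

* §1 `entireLFunctionRat_of_newformOfEllipticCurve` — support child **19273 `EntireLFunctionRat` ⟸ 19382 `NewformOfEllipticCurve`**
  (the tree's `WeierstrassCurve.hasEntireLFunction_rat_of_exists_isNewformOf`: modularity Version `L` ⇒ `L(E,s)` entire, in-kernel via
  Hecke); `publishedInputsFive_of_thirteen` — **19066 ⟸ 13 of its 15 conjuncts** (conjunct 7 `hasEntireLFunction_rat` ⟸ conjunct 8;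
  conjunct 15 `localEulerPoincareCharacteristic (K_v)` is the tree theorem `GaloisImage.EP.localEulerPoincareCharacteristic_adicCompletion`, Milne ADT I 2.8);
  `publishedInputsFive_of_twelve_of_selmerStructureDuality` — 19066 ⟸ 12 of its conjuncts + conjunct 13 of 19283 (conjunct 14
  `poitouTate_sum_localTatePairing_eq_zero K` ⟸ `poitouTate_selmerStructure_duality K`, seat g16's remark for 19283 applied to 19066).
* §2 `publishedInputs_pair_of_seventeen` — **`PublishedInputsIMCReduction ∧ PublishedInputsFive` ⟸ SEVENTEEN distinct named facts**
  (the 16 + 15 = 31 conjunct slots share nine constants; `cd ≤ 2`, local EPC, entire continuation and the Poitou–Tate sum formula are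
  tree theorems ∕ consequences): Gross–Zagier I.7.3, GZK (rank = r_an ≤ 1), Skinner 2016 Thm C, modularity (newform), Cai–Shu–Tian 1.1,
  Friedberg–Hoffstein (ramified ∕ split-Heegner ∕ inert forms), Mazur's Manin constant, Gross–Zagier ∕ Kolyvagin ∕ Kolyvagin 1990 over `K`,
  Hoffstein–Luo, Poitou–Tate (Selmer structures; Ш¹ × Ш²), Wuthrich 2014 Prop. 21, BDMTV 2019 Thm 1.2.
* §3 `multiplicativeRankOne_of_items_of_namedFacts` — **the K2 leaf ⟸ the route's SEVEN contentful items BY NAME** (cruxes 20529 [OPEN,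
  unrefereed], 19624, 19282, 19715, 19064, 19065; support 20495 [CLOSED, `jswSigmaLocalCharIdeal_holds`]) **+ FIVE held printed inputs BY
  LITERATURE NAME** (19625 (VN_p), 19524 Jacquet–Langlands data, 19716 Pasten component orders, 20191 Cassels–Tate level inputs, 20442
  Shimura Heegner-system primitives) **+ the SEVENTEEN named facts of §2** — `closes` rev 42 with `hF`, `h₅`, `hWu` REBUILT from atoms
  (29 hypotheses, each ONE named constant; no bundle). This is the route's complete input surface, kernel-certified.

HONEST FRAMING: theorems only (no definition, no named fact, no `sorry`); every statement CONDITIONAL on the listed items ∕ facts as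
hypotheses (20529 is OPEN and rests on [FW21 Thm. 4.41], unrefereed); no published fact is proved here; nothing is booked; BSD is proved
for no pair; no census word, tier or label moves (T7).

References: [Wuthrich2014] Prop. 21; [MilneADT2006] I Thm. 2.8, Thm. 4.10; [DiamondShurman2005] Thm. 8.8.3 ∕ 5.10.2; [BCDTJAMS2001] Thm. A;
[Castella2018Erratum] Thm. 1.1, (2.4)–(2.5); [FouquetWan2021] Thm. 4.41 (claim); [JetchevSkinnerWan2017] Thm. 3.3.1, proof of Thm. 6.1.6;
[Castella2018Exceptional] Thms. 2.10–2.11; [GrossZagier1986] I.7.3; [Kolyvagin1990] Thm. A; [Skinner2016PacificMC] Thm. C; [CaiShuTian2014]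
Thm. 1.1; [HoffsteinLuo1997]; [BalakrishnanEtAl2019] Thm. 1.2; [Harari2020] Thm. 17.13; [PastenShimura2024] §6; [JacquetLanglands1970].
-/

set_option autoImplicit false
-- the Theorems namespace of this sub repeats the summit name by design (D-0017 nested layout)
set_option linter.dupNamespace false

noncomputable section

open scoped Classical
open WeierstrassCurve NumberField IsDedekindDomain
open Literature.NumberTheory.EllipticCurves Literature.NumberTheory.EllipticCurves.ModularForms
  Literature.NumberTheory.EllipticCurves.Rank1Residual Literature.NumberTheory.EllipticCurves.JetchevSkinnerWan2017
  Literature.NumberTheory.EllipticCurves.Castella2018 Literature.NumberTheory.GaloisCohomology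
  Literature.NumberTheory.GaloisRepresentations Literature.NumberTheory.Automorphic
open Summit.BirchSwinnertonDyer.Rank1Residual.X11b
open Summit.BirchSwinnertonDyer.BirchSwinnertonDyer.Theses.ErratumRoadFive

namespace Summit.BirchSwinnertonDyer.BirchSwinnertonDyer.Theorems

/-! ### §1 Support 19066 `PublishedInputsFive` from thirteen (twelve) of its fifteen conjuncts -/

/-- **Support child 19273 `EntireLFunctionRat` BY NAME from support child 19382 `NewformOfEllipticCurve`**: modularity Version `L`
⇒ `L(E,s)` entire, the tree's `WeierstrassCurve.hasEntireLFunction_rat_of_exists_isNewformOf` (in-kernel via Hecke's continuation of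
`L(f,s)`). CONDITIONAL on 19382; nothing booked. [cite: DiamondShurman2005, Thm. 8.8.3 and Thm. 5.10.2] [cite: BCDTJAMS2001, Theorem A] -/
theorem entireLFunctionRat_of_newformOfEllipticCurve (hnf : NewformOfEllipticCurve) : EntireLFunctionRat :=
  WeierstrassCurve.hasEntireLFunction_rat_of_exists_isNewformOf hnf

/-- **Support 19066 `PublishedInputsFive` from THIRTEEN of its fifteen conjuncts**: conjunct 7 (`hasEntireLFunction_rat`) ⟸ conjunct 8
(`exists_isNewformOf`); conjunct 15 (local Euler–Poincaré characteristic) is a tree theorem. CONDITIONAL on the thirteen; nothing booked.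
[cite: DiamondShurman2005, Thm. 8.8.3] [cite: MilneADT2006, Ch. I, Thm. 2.8] [cite: Wuthrich2014, Prop. 21 (p. 400)] -/
theorem publishedInputsFive_of_thirteen
    (hGZ : ∀ (N : ℕ) [NeZero N] (W : WeierstrassCurve ℚ) (K : Type) [Field K] [NumberField K], gross_zagier N W K)
    (hKo : ∀ (N : ℕ) [NeZero N] (W : WeierstrassCurve ℚ) (K : Type) [Field K] [NumberField K], kolyvagin N W K)
    (hB : ∀ (N : ℕ) [NeZero N] (W : WeierstrassCurve ℚ) (K : Type) [Field K] [NumberField K],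
      Kolyvagin1990_padicValNat_card_sha_le N W K)
    (hSk : Skinner2016.thmC_padicValRat_bsd_rank_zero) (hWu : Wuthrich2014.sha_dvd_analyticSha)
    (hGZK : rank_eq_analyticRank_of_analyticRank_le_one) (hnf : exists_isNewformOf)
    (hHL : HoffsteinLuo1997_exists_twist_L_one_ne_zero) (hFHs : friedbergHoffstein_exists_heegnerField_split_twist_ne_zero)
    (hMaz : mazur_not_dvd_maninConstant_of_odd) (hBDMTV : BalakrishnanEtAl2019.thm12_not_le_normalizer_splitCartan)
    (hFH : friedbergHoffstein_exists_twist_ne_zero_inertAt)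
    (hPT : ∀ (K : Type) [Field K] [NumberField K], poitouTate_sum_localTatePairing_eq_zero K) : PublishedInputsFive :=
  ⟨hGZ, hKo, hB, hSk, hWu, hGZK, WeierstrassCurve.hasEntireLFunction_rat_of_exists_isNewformOf hnf, hnf, hHL, hFHs, hMaz,
    hBDMTV, hFH, hPT, Summit.BirchSwinnertonDyer.Rank1Residual.GaloisImage.EP.localEulerPoincareCharacteristic_adicCompletion⟩

/-- **Support 19066 from TWELVE of its conjuncts plus conjunct 13 of support 19283** (`poitouTate_selmerStructure_duality`): conjunct 14
(the Poitou–Tate reciprocity half `∑_v inv_v = 0` for Selmer structures) follows from the Selmer-structure duality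
(`poitouTate_sum_localTatePairing_eq_zero_of_selmerStructure_duality`). CONDITIONAL; nothing booked.
[cite: MilneADT2006, Ch. I, Thm. 4.10 and Thm. 2.8] [cite: DiamondShurman2005, Thm. 8.8.3] -/
theorem publishedInputsFive_of_twelve_of_selmerStructureDuality
    (hGZ : ∀ (N : ℕ) [NeZero N] (W : WeierstrassCurve ℚ) (K : Type) [Field K] [NumberField K], gross_zagier N W K)
    (hKo : ∀ (N : ℕ) [NeZero N] (W : WeierstrassCurve ℚ) (K : Type) [Field K] [NumberField K], kolyvagin N W K)
    (hB : ∀ (N : ℕ) [NeZero N] (W : WeierstrassCurve ℚ) (K : Type) [Field K] [NumberField K],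
      Kolyvagin1990_padicValNat_card_sha_le N W K)
    (hSk : Skinner2016.thmC_padicValRat_bsd_rank_zero) (hWu : Wuthrich2014.sha_dvd_analyticSha)
    (hGZK : rank_eq_analyticRank_of_analyticRank_le_one) (hnf : exists_isNewformOf)
    (hHL : HoffsteinLuo1997_exists_twist_L_one_ne_zero) (hFHs : friedbergHoffstein_exists_heegnerField_split_twist_ne_zero)
    (hMaz : mazur_not_dvd_maninConstant_of_odd) (hBDMTV : BalakrishnanEtAl2019.thm12_not_le_normalizer_splitCartan)
    (hFH : friedbergHoffstein_exists_twist_ne_zero_inertAt)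
    (h13 : ∀ (K : Type) [Field K] [NumberField K], poitouTate_selmerStructure_duality K) : PublishedInputsFive :=
  publishedInputsFive_of_thirteen hGZ hKo hB hSk hWu hGZK hnf hHL hFHs hMaz hBDMTV hFH
    fun K _ _ ↦ poitouTate_sum_localTatePairing_eq_zero_of_selmerStructure_duality (h13 K)

/-! ### §2 The two published-input bundles of `closes` from seventeen distinct named facts -/

/-- **`PublishedInputsIMCReduction ∧ PublishedInputsFive` (supports 19283 ∧ 19066: 16 + 15 = 31 conjunct slots) ⟸ SEVENTEEN distinct
named facts.** The nine constants shared by the two bundles are bound once; `fieldCdLE_two_of_numberField` and the local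
Euler–Poincaré characteristic are tree theorems; the entire continuation follows from modularity and the Poitou–Tate sum formula from
the Selmer-structure duality. CONDITIONAL on the seventeen; nothing booked; no fact is proved here.
[cite: MilneADT2006, Ch. I, Thm. 4.10 and Thm. 2.8] [cite: DiamondShurman2005, Thm. 8.8.3] [cite: Harari2020, Thm. 17.13 (b)] -/
theorem publishedInputs_pair_of_seventeen
    (f1 : GrossZagier1986_thm_I_7_3) (f2 : rank_eq_analyticRank_of_analyticRank_le_one)
    (f3 : Skinner2016.thmC_padicValRat_bsd_rank_zero) (f4 : exists_isNewformOf)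
    (f5 : CaiShuTian2014.thm11_trivialChar) (f6 : friedbergHoffstein_exists_twist_ne_zero_ramifiedAt)
    (f7 : mazur_not_dvd_maninConstant_of_odd)
    (f8 : ∀ (N : ℕ) [NeZero N] (W : WeierstrassCurve ℚ) (K : Type) [Field K] [NumberField K], gross_zagier N W K)
    (f9 : ∀ (N : ℕ) [NeZero N] (W : WeierstrassCurve ℚ) (K : Type) [Field K] [NumberField K], kolyvagin N W K)
    (f10 : ∀ (N : ℕ) [NeZero N] (W : WeierstrassCurve ℚ) (K : Type) [Field K] [NumberField K],
      Kolyvagin1990_padicValNat_card_sha_le N W K)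
    (f11 : HoffsteinLuo1997_exists_twist_L_one_ne_zero)
    (f12 : ∀ (K : Type) [Field K] [NumberField K], poitouTate_selmerStructure_duality K)
    (f13 : ∀ (K : Type) [Field K] [NumberField K], poitouTate_sha_tateDual K)
    (f14 : Wuthrich2014.sha_dvd_analyticSha) (f15 : friedbergHoffstein_exists_heegnerField_split_twist_ne_zero)
    (f16 : BalakrishnanEtAl2019.thm12_not_le_normalizer_splitCartan) (f17 : friedbergHoffstein_exists_twist_ne_zero_inertAt) :
    PublishedInputsIMCReduction ∧ PublishedInputsFive :=
  ⟨⟨f1, f2, f3, f4, f5, f6, f7, f8, f9, f10, f11,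
      fun K _ _ ↦ poitouTate_sum_localTatePairing_eq_zero_of_selmerStructure_duality (f12 K), f12, f13,
      Summit.BirchSwinnertonDyer.Rank1Residual.GaloisImage.EP.localEulerPoincareCharacteristic_adicCompletion,
      fieldCdLE_two_of_numberField_holds⟩,
    publishedInputsFive_of_twelve_of_selmerStructureDuality f8 f9 f10 f3 f14 f2 f4 f11 f15 f7 f16 f17 f12⟩

/-! ### §3 The K2 leaf from the route's contentful items, the held inputs and the seventeen named facts — the input surface -/

/-- **THE INPUT SURFACE OF RUNG K2 (route `ErratumRoadFive`, rev 42), ATOMISED AND KERNEL-CHECKED.** `X11b.MultiplicativeRankOne`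
(BSD(E,p) on all of class X11b at `p ≥ 5`) from TWENTY-NINE hypotheses, each ONE named constant:
(items) the six OPEN cruxes `CastellaErratumMemberPackage` (20529 — the erratum-currency open input, UNREFEREED),
`RamNoErratumDataAtFive` (19624), `OpenInputNotRam` (19282), `EulerHalfNotRamNoInertSetAtFive` (19715), `X11aLowerHalf` (19064),
`NonSurjCorner` (19065), and the CLOSED support `JSWSigmaLocalCharIdeal` (20495, `jswSigmaLocalCharIdeal_holds`);
(held printed inputs, by Literature name) (VN_p) `castella2018Exceptional_bdpValueContinuity_trivialChar` (19625), Jacquet–Langlands data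
`nonempty_shimuraParametrizationData` (19524), `PastenShimura2024_componentOrders` (19716), `casselsTate_levelInputs` (20191),
`shimuraCurve_heegnerSystem_primitivesFromFive` (20442); (named facts) the seventeen of §2. Proof = `closes` rev 42 with its bundles `hF`
(19283), `h₅` (19066) and its binder `hWu` (19285) REBUILT from the atoms (§2), every other step verbatim. CONDITIONAL on all 29;
nothing booked; BSD is proved for no pair; no census word, tier or label moves (T7).
[claim: Castella2018Erratum, status: under-review] [claim: FouquetWan2021, status: under-review]
[cite: Castella2018Erratum, Thm. 1.1 and (2.4)–(2.5) (pp. 1–4)] [cite: JetchevSkinnerWan2017, Thm. 3.3.1 with §3.5 (3.5.c); proof of Thm. 6.1.6]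
[cite: Castella2018Exceptional, Thms. 2.10–2.11] [cite: Wuthrich2014, Prop. 21 (p. 400)] [cite: MilneADT2006, Ch. I, Thm. 4.10 and Thm. 2.8] -/
theorem multiplicativeRankOne_of_items_of_namedFacts
    -- the route's contentful items (6 open cruxes + 1 closed support)
    (hMem : CastellaErratumMemberPackage) (hloc : JSWSigmaLocalCharIdeal)
    (hrest : RamNoErratumDataAtFive) (hOff : OpenInputNotRam)
    (hRes : EulerHalfNotRamNoInertSetAtFive) (h₃ : X11aLowerHalf) (h₄ : NonSurjCorner)
    -- the five held printed inputs, by Literature name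
    (hVN : castella2018Exceptional_bdpValueContinuity_trivialChar) (hJL : nonempty_shimuraParametrizationData)
    (hCO : PastenShimura2024_componentOrders)
    (hCTi : ∀ (K : Type) [Field K] [NumberField K], casselsTate_levelInputs K)
    (hESi : shimuraCurve_heegnerSystem_primitivesFromFive)
    -- the seventeen named facts
    (f1 : GrossZagier1986_thm_I_7_3) (f2 : rank_eq_analyticRank_of_analyticRank_le_one)
    (f3 : Skinner2016.thmC_padicValRat_bsd_rank_zero) (f4 : exists_isNewformOf)
    (f5 : CaiShuTian2014.thm11_trivialChar) (f6 : friedbergHoffstein_exists_twist_ne_zero_ramifiedAt)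
    (f7 : mazur_not_dvd_maninConstant_of_odd)
    (f8 : ∀ (N : ℕ) [NeZero N] (W : WeierstrassCurve ℚ) (K : Type) [Field K] [NumberField K], gross_zagier N W K)
    (f9 : ∀ (N : ℕ) [NeZero N] (W : WeierstrassCurve ℚ) (K : Type) [Field K] [NumberField K], kolyvagin N W K)
    (f10 : ∀ (N : ℕ) [NeZero N] (W : WeierstrassCurve ℚ) (K : Type) [Field K] [NumberField K],
      Kolyvagin1990_padicValNat_card_sha_le N W K)
    (f11 : HoffsteinLuo1997_exists_twist_L_one_ne_zero)
    (f12 : ∀ (K : Type) [Field K] [NumberField K], poitouTate_selmerStructure_duality K)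
    (f13 : ∀ (K : Type) [Field K] [NumberField K], poitouTate_sha_tateDual K)
    (f14 : Wuthrich2014.sha_dvd_analyticSha) (f15 : friedbergHoffstein_exists_heegnerField_split_twist_ne_zero)
    (f16 : BalakrishnanEtAl2019.thm12_not_le_normalizer_splitCartan) (f17 : friedbergHoffstein_exists_twist_ne_zero_inertAt) :
    Summit.BirchSwinnertonDyer.Rank1Residual.X11b.MultiplicativeRankOne := by
  obtain ⟨hF, h₅⟩ := publishedInputs_pair_of_seventeen f1 f2 f3 f4 f5 f6 f7 f8 f9 f10 f11 f12 f13 f14 f15 f16 f17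
  -- from here: `closes` rev 42 minus the binder `hWu` (read from `h₅`), verbatim
  show Summit.BirchSwinnertonDyer.Rank1Residual.X11b.MultiplicativeRankOne
  have h3 : IMCDivAtErratumDataAllR := fun W _ _ p _ ↦
    Summit.BirchSwinnertonDyer.Rank1Residual.X11b.P2.imcDivIntCoreFrameAtErratumDataB_of_roadFF_fitting
      (Summit.BirchSwinnertonDyer.Rank1Residual.X11b.P2.RoadFF.sigmaDataAtErratumDataB_of_sigmaLocal_of_prop323_of_facts
        W p hloc Literature.NumberTheory.EllipticCurves.SkinnerUrban2014.prop323_XAc_equiv_XBigDecomp_holds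
        hF.2.1 hF.2.2.2.1 hF.2.2.2.2.2.2.2.2.2.2.2.2.1 hF.2.2.2.2.2.2.2.2.2.2.2.2.2.1)
      (Summit.BirchSwinnertonDyer.Rank1Residual.X11b.P2.RoadFF.fittingCongruenceFrameAtErratumDataB_of_members_of_prop323
        hMem Literature.NumberTheory.EllipticCurves.SkinnerUrban2014.prop323_XAc_equiv_XBigDecomp_holds W p)
  obtain ⟨hGZ, hKo, hB, hSk, hWu', hGZK, hmod, hnf, hHL, hFHs, hMaz, hBDMTV, hFH, hPT, hEP⟩ := h₅
  have hESg : Literature.NumberTheory.EllipticCurves.shimuraCurve_heegnerSystem_primitivesGuarded :=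
    Summit.BirchSwinnertonDyer.BirchSwinnertonDyer.Theorems.primitivesGuarded_of_GZK_of_entire_of_primitivesFromFive
      hGZK hmod hESi
  have hKOi : ShimuraKolyvaginOrderBoundInertFromFive := by
    refine Summit.BirchSwinnertonDyer.BirchSwinnertonDyer.Theorems.shimuraKolyvaginOrderBoundInert_of_shimuraLabelsGuarded_of_casselsTate_of_poitouTate
      hPT ?_ hESg
    intro K _ _ W _ p M₀ hp hp2 hM₀ _ c hc hcc e hμ hadd₁ hadd₂ hgal halt hnd
    obtain ⟨inv, hPT', hH3, hperf, hB', hPτ⟩ := hCTi K W p M₀ hp hp2 hM₀ c hc hcc e hμ hadd₁ hadd₂ hgal halt hnd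
    exact ⟨inv, hPT', hH3, fun v ↦ (hperf v).1.injective, hB', hPτ⟩
  have hHKi : Literature.NumberTheory.EllipticCurves.shimuraCurve_heegnerPoint_grossZagier_kolyvagin_inert := by
    intro W _ _ p _ N _ K _ _ S Dt X W' _ P₀ hN hp5 hsurj hK hS hin hsp hpS hc hmin
    obtain ⟨-, y, degy, -, -, h0y, hvy, hLy, -⟩ := hESg W p N K S Dt X W' P₀ hN hp5 hsurj hK hS hin hsp hpS hc hmin
    exact ⟨y, degy, h0y, hvy, hLy,
      hKOi W p N K S Dt X W' P₀ hN hp5 hsurj hK hS hin hsp hpS hc hmin y degy h0y hvy hLy⟩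
  have h₁ : ∀ (W : WeierstrassCurve ℚ) [W.IsElliptic] [W.IsGloballyMinimal] (p : ℕ) [Fact p.Prime],
      Summit.BirchSwinnertonDyer.Rank1Residual.X11b.P2OpenInputOnTreeAt W p :=
    Summit.BirchSwinnertonDyer.BirchSwinnertonDyer.Theorems.KernelFromPrintB.openInputIMCBody_of_print_of_coreB_of_rest3_of_notRam_of_facts
      hVN h3 hF hWu' hrest hOff
  exact Summit.BirchSwinnertonDyer.BirchSwinnertonDyer.Theorems.multiplicativeRankOne_of_endState_inert_notRamResidual
    hGZ hKo hB hSk hWu' hGZK hmod hnf hHL hFHs hMaz hBDMTV hFH hPT hEP hJL hCO hHKi h₁ hRes h₃ h₄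

end Summit.BirchSwinnertonDyer.BirchSwinnertonDyer.Theorems

end
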